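import Literature.AnabelianGeometry.AbsoluteAnabelian.ProSigmaMaximalQuotientKernelCharacters
import Literature.AnabelianGeometry.AbsoluteAnabelian.FreeProlRankQuotientProofs
import Literature.AnabelianGeometry.AbsoluteAnabelian.ProfiniteElasticCriterionAffineProofs
import Literature.AnabelianGeometry.AbsoluteAnabelian.MLFGaloisElasticProofs
import Literature.GroupTheory.ProfiniteSubquotients
import HarnessLib

/-!
# [AbsTopI] Thm 1.7 (ii), quotient clause: almost pro-`Σ`-maximal quotients of `G_k` (`p ∈ Σ`) are elastic

S. Mochizuki, *Topics in Absolute Anabelian Geometry I: Generalities* (2012) [AbsTopI] (lit key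
`paper:url-11ac98ba15fc`), Thm 1.7 (ii) p. 14: "If `k` is an MLF of residue characteristic `p`, then
`G_k`, as well as any almost pro-`p`-maximal quotient `G_k ↠ Q` of `G_k`, is elastic and slim", with Def 1.1
(iii) p. 10: "`G ↠ Q` [is] almost pro-`Σ`-maximal if for some normal open subgroup `N ⊆ G` with maximal
pro-`Σ` quotient `N ↠ P`, we have `Ker(G ↠ Q) = Ker(N ↠ P)`."  The tree has the ELASTICITY of `G_k` itself
(abc-iut-w5-d206's `isElastic_absoluteGaloisGroup`, via abc-iut's criterion); this PROOF-ONLY file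
(no definitions; the kernel `K = Ker(N ↠ P)` enters by the membership hypothesis of
`ProSigmaMaximalQuotientKernel.lean`) proves the **elasticity of the quotients `Q = G_k / K`** for every
open `N ⊆ G_k` and every `Σ ∋ p` (print: `Σ = {p}`; `N` normal is not needed for elasticity):

* `isElastic_quotient_of_affine_rankFormula` — GENERIC: for a profinite `Γ` with affine rank formula
  `δ¹_p(U) = c·[Γ:U] + e` (`c ≥ 1`) on open subgroups and a closed normal `K` with `Hom_cont(K, ℤ_pⁿ) = 1`,
  the quotient `Γ/K` is elastic: its open subgroups `U/K` have `δ¹_p(U/K) = δ¹_p(U)`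
  (`freeProlRank_quotient_subgroupOf_eq_of_forall_hom_eq_one`) and `[Γ/K : U/K] = [Γ : U]`, so the same
  affine formula holds on `Γ/K` and abc-iut's `isElastic_of_affine_rankFormula` applies;
* `isElastic_absoluteGaloisGroup_quotient_proSigmaKernel` — **[AbsTopI] Thm 1.7 (ii), quotient clause**:
  for `K/ℚ_p` finite, `N ⊆ G_K` open, `Σ ∋ p`, and `K_Σ ⊆ N` the kernel of the maximal pro-`Σ` quotient
  of `N` (normal in `G_K`), the quotient `G_K / K_Σ` is elastic — rank formula
  `δ¹_p(U) = [K:ℚ_p]·[G_K:U] + 1` (`freeProlRank_eq_of_isOpen_absoluteGaloisGroup`) and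
  `Hom_cont(K_Σ, ℤ_pⁿ) = 1` (`padicIntPi_hom_eq_one`).

The print's slimness of `Q` (local class field theory) is not treated here.  Classical; nothing here
bears on [IUTchIII] Cor. 3.12.
-/

noncomputable section

open Topology

universe u

namespace Literature.AnabelianGeometry.AbsoluteAnabelian

open Literature.AnabelianGeometry.Anabelioids (IsSigmaInteger)
open Literature.GroupTheory.ProfiniteSubquotients

/-! ### Generic: elasticity descends to quotients by `ℤ_p`-invisible closed normal subgroups -/

/-- **Elasticity of `Γ/K` from an affine rank formula on `Γ` and `Hom_cont(K, ℤ_pⁿ) = 1`.**  For `Γ`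
profinite with `δ¹_p(U) = c·[Γ:U] + e` (`c ≥ 1`) for all open `U ⊆ Γ`, and `K ⊴ Γ` closed with every
continuous homomorphism `K → ℤ_pⁿ` trivial: every open subgroup of `Γ/K` is `U/K` for an open `U ⊇ K`,
`U/K ≅ U/(K ∩ U)` topologically, `δ¹_p(U/K) = δ¹_p(U)` and `[Γ/K : U/K] = [Γ : U]`; so `Γ/K` satisfies
the same affine rank formula and is elastic by `isElastic_of_affine_rankFormula`.
[cite: MochizukiAbsTopI2012, Thm 1.7 (ii) p.14] -/
theorem isElastic_quotient_of_affine_rankFormula {Γ : Type u} [Group Γ] [TopologicalSpace Γ]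
    [IsTopologicalGroup Γ] [CompactSpace Γ] [T2Space Γ] [TotallyDisconnectedSpace Γ]
    (p c e : ℕ) [Fact p.Prime] (hc : 0 < c)
    (hRF : ∀ U : Subgroup Γ, IsOpen (U : Set Γ) → freeProlRank U p = ((c * U.index + e : ℕ) : ℕ∞))
    (K : Subgroup Γ) [K.Normal] (hKc : IsClosed (K : Set Γ))
    (hKchar : ∀ (n : ℕ) (φ : K →ₜ* Multiplicative (Fin n → ℤ_[p])), ∀ k, φ k = 1) :
    IsElastic (Γ ⧸ K) := by
  classical
  haveI : IsClosed (K : Set Γ) := hKc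
  haveI : TotallyDisconnectedSpace (Γ ⧸ K) := totallyDisconnectedSpace_quotient K hKc
  refine isElastic_of_affine_rankFormula p c e hc fun UQ hUQo => ?_
  let π : Γ →* Γ ⧸ K := QuotientGroup.mk' K
  have hπ : Function.Surjective π := QuotientGroup.mk'_surjective K
  have hπc : Continuous π := QuotientGroup.continuous_mk
  let U : Subgroup Γ := UQ.comap π
  have hUo : IsOpen (U : Set Γ) := hUQo.preimage hπc
  have hKU : K ≤ U := by
    intro k hk
    rw [Subgroup.mem_comap]
    have : π k = 1 := (QuotientGroup.eq_one_iff k).mpr hk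
    rw [this]; exact UQ.one_mem
  have hidx : UQ.index = U.index := (Subgroup.index_comap_of_surjective UQ hπ).symm
  -- `r : U ↠ UQ`, continuous, kernel `K ∩ U`
  let r : U →* UQ :=
    { toFun := fun u => ⟨π (u : Γ), u.2⟩
      map_one' := Subtype.ext (by simp)
      map_mul' := fun a b => Subtype.ext (by simp) }
  have hrc : Continuous r := (hπc.comp continuous_subtype_val).subtype_mk _
  have hrs : Function.Surjective r := by
    rintro ⟨y, hy⟩
    obtain ⟨g, rfl⟩ := hπ y
    exact ⟨⟨g, hy⟩, rfl⟩
  have hker : r.ker = K.subgroupOf U := by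
    ext u
    rw [MonoidHom.mem_ker, Subgroup.mem_subgroupOf]
    constructor
    · intro h
      have h' : π (u : Γ) = 1 := congrArg Subtype.val h
      exact (QuotientGroup.eq_one_iff (u : Γ)).mp h'
    · intro h
      exact Subtype.ext ((QuotientGroup.eq_one_iff (u : Γ)).mpr h)
  haveI : CompactSpace U := compactSpace_of_isOpen hUo
  haveI : (K.subgroupOf U).Normal := Subgroup.normal_subgroupOf
  obtain ⟨eU, -⟩ := nonempty_continuousMulEquiv_quotient_of_surjective r hrc hrs (K.subgroupOf U) hker
  rw [hidx, ← hRF U hUo, ← freeProlRank_eq_of_continuousMulEquiv eU p]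
  exact freeProlRank_quotient_subgroupOf_eq_of_forall_hom_eq_one K U hKU p hKchar

/-! ### [AbsTopI] Thm 1.7 (ii): the quotient clause for `G_K`, `K/ℚ_p` finite -/

/-- **[AbsTopI] Thm 1.7 (ii), quotient clause (elasticity)**: for `K/ℚ_p` finite, an open subgroup
`N ⊆ G_K`, a set of primes `Σ ∋ p`, and the kernel `K_Σ ⊆ N` of the maximal pro-`Σ` quotient `N ↠ P`
(membership: `x ∈ K_Σ ↔ x ∈ W` for every open normal `W ⊴ N` of `Σ`-integer index), normal in `G_K`
(an instance hypothesis; when `N` is normal it is discharged by `normal_of_proSigmaKernel_of_normal`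
below — `K_Σ` is characteristic in `N`), the
quotient `G_K / K_Σ` — print's "almost pro-`p`-maximal quotient `G_k ↠ Q`" for `Σ = {p}` — is ELASTIC.
[cite: MochizukiAbsTopI2012, Thm 1.7 (ii) p.14] -/
theorem isElastic_absoluteGaloisGroup_quotient_proSigmaKernel (p : ℕ) [Fact p.Prime] (K : Type)
    [Field K] [Algebra ℚ_[p] K] [FiniteDimensional ℚ_[p] K] {S : Set ℕ} (hpS : p ∈ S)
    (N : Subgroup (Field.absoluteGaloisGroup K)) (hNo : IsOpen (N : Set (Field.absoluteGaloisGroup K)))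
    (KS : Subgroup (Field.absoluteGaloisGroup K)) [KS.Normal] (hKSN : KS ≤ N)
    (hKS : ∀ x : N, (x : Field.absoluteGaloisGroup K) ∈ KS ↔
      ∀ W : Subgroup N, W.Normal → IsOpen (W : Set N) → IsSigmaInteger S W.index → x ∈ W) :
    IsElastic (Field.absoluteGaloisGroup K ⧸ KS) := by
  classical
  haveI : CharZero K := charZero_of_injective_algebraMap (algebraMap ℚ_[p] K).injective
  -- the kernel inside the profinite group `N`
  haveI : CompactSpace N := compactSpace_of_isOpen hNo
  let K' : Subgroup N := KS.subgroupOf N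
  have hK' : ∀ x : N, x ∈ K' ↔
      ∀ W : Subgroup N, W.Normal → IsOpen (W : Set N) → IsSigmaInteger S W.index → x ∈ W := by
    intro x; rw [Subgroup.mem_subgroupOf]; exact hKS x
  -- `KS` is closed: the image of the closed `K' ⊆ N` under the closed embedding `N ↪ G_K`
  have hKSc : IsClosed (KS : Set (Field.absoluteGaloisGroup K)) := by
    have hK'c : IsClosed (K' : Set N) := isClosed_of_mem_family hK'
    have hset : (KS : Set (Field.absoluteGaloisGroup K)) = Subtype.val '' (K' : Set N) := by
      ext x
      constructor
      · intro hx
        exact ⟨⟨x, hKSN hx⟩, Subgroup.mem_subgroupOf.mpr hx, rfl⟩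
      · rintro ⟨y, hy, rfl⟩
        exact Subgroup.mem_subgroupOf.mp hy
    rw [hset]
    exact (Subgroup.isClosed_of_isOpen N hNo).isClosedEmbedding_subtypeVal.isClosedMap _ hK'c
  -- `Hom_cont(KS, ℤ_pⁿ) = 1`, transported from `K'`
  have hKchar : ∀ (n : ℕ) (φ : KS →ₜ* Multiplicative (Fin n → ℤ_[p])), ∀ k, φ k = 1 := by
    intro n φ k
    let j : K' →ₜ* KS :=
      { toFun := fun y => ⟨((y : N) : Field.absoluteGaloisGroup K), Subgroup.mem_subgroupOf.mp y.2⟩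
        map_one' := rfl
        map_mul' := fun _ _ => rfl
        continuous_toFun := (continuous_subtype_val.comp continuous_subtype_val).subtype_mk _ }
    have hk : j ⟨⟨(k : Field.absoluteGaloisGroup K), hKSN k.2⟩, Subgroup.mem_subgroupOf.mpr k.2⟩ = k :=
      rfl
    rw [← hk]
    exact padicIntPi_hom_eq_one hK' hpS (φ.comp j) _
  exact isElastic_quotient_of_affine_rankFormula p (Module.finrank ℚ_[p] K) 1 Module.finrank_pos
    (fun U hU => freeProlRank_eq_of_isOpen_absoluteGaloisGroup p K U hU) KS hKSc hKchar

/-! ### Normality of `Ker(N ↠ P)` in `G` for `N` normal -/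

/-- For `N ⊴ G` normal and open and `K_Σ ⊆ N` the kernel of the maximal pro-`Σ` quotient of `N`
(membership hypothesis inside `N`), `K_Σ` is NORMAL in `G`: conjugation by `g ∈ G` restricts to a
continuous automorphism of `N`, which permutes the open normal `Σ`-index subgroups of `N` ("`K_Σ` is
characteristic in `N`").  This makes `G ↠ G/K_Σ` a quotient GROUP, as in [AbsTopI] Def 1.1 (iii).
[cite: MochizukiAbsTopI2012, Def 1.1 (iii) p.10] -/
theorem normal_of_proSigmaKernel_of_normal {G : Type u} [Group G] [TopologicalSpace G]
    [IsTopologicalGroup G] {S : Set ℕ} (N : Subgroup G) [hN : N.Normal]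
    (KS : Subgroup G) (hKSN : KS ≤ N)
    (hKS : ∀ x : N, (x : G) ∈ KS ↔
      ∀ W : Subgroup N, W.Normal → IsOpen (W : Set N) → IsSigmaInteger S W.index → x ∈ W) :
    KS.Normal := by
  refine ⟨fun x hx g => ?_⟩
  have hxN : x ∈ N := hKSN hx
  have hgxN : g * x * g⁻¹ ∈ N := hN.conj_mem x hxN g
  refine (hKS ⟨g * x * g⁻¹, hgxN⟩).mpr fun W hWn hWo hWS => ?_
  -- conjugation by `g` on `N`
  let c : N →* N :=
    { toFun := fun n => ⟨g * n * g⁻¹, hN.conj_mem _ n.2 g⟩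
      map_one' := Subtype.ext (by simp)
      map_mul' := fun a b => Subtype.ext (by
        simp only [Subgroup.coe_mul]
        group) }
  have hcc : Continuous c :=
    ((continuous_const.mul (continuous_subtype_val)).mul continuous_const).subtype_mk _
  have hcs : Function.Surjective c := by
    intro n
    refine ⟨⟨g⁻¹ * n * g, by simpa using hN.conj_mem _ n.2 g⁻¹⟩, Subtype.ext ?_⟩
    change g * (g⁻¹ * n * g) * g⁻¹ = n
    group
  -- `W' := c⁻¹(W)` is again open, normal, of the same index
  let W' : Subgroup N := W.comap c
  have hW'n : W'.Normal := inferInstance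
  have hW'o : IsOpen (W' : Set N) := hWo.preimage hcc
  have hW'S : IsSigmaInteger S W'.index := by
    change IsSigmaInteger S (W.comap c).index
    rw [Subgroup.index_comap_of_surjective W hcs]
    exact hWS
  have hx' : (⟨x, hxN⟩ : N) ∈ W' := (hKS ⟨x, hxN⟩).mp hx W' hW'n hW'o hW'S
  rw [Subgroup.mem_comap] at hx'
  exact hx'

end Literature.AnabelianGeometry.AbsoluteAnabelian

end
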